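import Summits.ResolutionOfSingularities.ResolutionOfSingularities.Theorems.JetCutPoint
import HarnessLib

/-!
# JetCutPoint2 — decomp-res node «JetCut» (lens-2 g15 rev 5), file 2/2 of `JetCutPoint`

Content VERBATIM from the decomp-res lens-2 file `HOME/decomp-res-lens-2/g15/JetCut.lean` rev 5 (pin 9f53e5ca =
`parts/JetCut-rev5-9f53e5ca.lean`, 7 495 l;
HOME = run/shared/lean/pub/decomp-res; CRITIC-LEDGER rows 109 / 115 / 120 / 121 / 122 / 127 / 133 CLEARED; landing
order INBOX :231; the critic's
HYGIENE-landing.md h1–h11 applied — DOCSTRING-ONLY).  The lens's blocks RESTATED VERBATIM from lens-2 g12 / g13 /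
g14 (§R / §R13 / §R14) are DELETED:
they are the tree's `RelativeDeltaCut*` / `CurveLeafExit*` / `PinchCut*` modules (namespaces `RelativeDeltaCut`,
`CurveLeafExit`, `PinchCut`, opened;
the lens's `CurveLeafExitRestated.x` / `PinchCutRestated.x` are cited as `CurveLeafExit.x` / `PinchCut.x`, the three
pointwise engine edges of g12 as
`RelativeDeltaCut.x`).  Namespace `…Theorems.JetCut` (the lens's `Theses.JetCut` is gate-reserved), sub-namespaces
`Tame` / `Wide` / `Broad` / `Vast`
as in the lens; file split only (tree files ≤ 400 lines): sections, variables and every declaration exactly as in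
the lens, the long rev-0/1 prose
lives in HOME/decomp-res-lens-2/g15/NODE-g15.md §ARCHIVE-A (not in the tree).  Node files, in import order:
`JetCutJetKernels`, `JetCutPoint`, `JetCutClasses`, `JetCutKernels`, `JetCutTame`, `JetCutTameClasses`,
`JetCutTameKernels`, `JetCutLadder`, `JetCutWideClasses`, `JetCutWideKernels`, `JetCutMixed`, `JetCutBroadClasses`,
`JetCutBroadKernels`, `JetCutDegenerate`, `JetCutVastClasses`, `JetCutVastKernels`
(each possibly continued `…2`, `…3`), then the wiring `MaxContactCutJetCut*` (in the Theses cone).  All `--supports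
stmt-ResolutionOfSingularities-29273`
(`MaxContactCut.RungOne`); nothing closes 29273 — decided cells carry their engines as hypotheses, and exactly ONE
located-residual aside is booked on
the route for this column (`Vast.VastSpecialRung`, home `JetCutVastClasses`).

§J2 + §J3 + §J3b + §J3b′ + §J3c: POINT LEVEL — jet-shallow closed points `IsJetShallowAt`, uniformly jet-shallow
curves, ENGINE (J) `JetExit`, the pointwise classes (jet-curve / cone-tail-curve / jet-special points), the
point-level kernels (every cone-curve point is a jet-curve point; (CT) ⊆ (J) at point level modulo the port), and
the LENGTH-TWO LAW (J2): `JetTwoShallow`, `IsJetTwoAt`, ENGINE (J2) `JetTwoExit`, with its ring kernels.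

Part 2/2 carries: `IsJetTwoCurvePt`, `IsJetTwoSpecialPt`, `isJetTwoShallowAt_of_isJetShallowAt`,
`isUniformJetTwoCurve_of_isUniformJetCurve`, `isJetTwoCurvePt_of_isJetCurvePt`, `isJetTwoCurvePt_of_isConeCurvePt`,
`isJetTwoCurvePt_of_isConeTailCurvePt`, `jetExit_of_jetTwoExit`, `flatConeExit_of_jetTwoExit`,
`isJetSpecialPt_split`, `isJetSpecialPt_of_isJetTwoSpecialPt`, `SeqJGen`.

(Sources: HunekeSwanson2006 Cor. 5.5.5; CossartJannsenSaito2020 Ch. 2, Thm. 3.6/3.7, Ch. 8; CossartPiltant2008 Prop.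
4.2; CossartPiltant2019 Rem. 3.2; Hironaka1964 Ch. III; Hironaka1967; Hironaka1977; Moh1987; Giraud1975.)
-/

open CategoryTheory AlgebraicGeometry TopologicalSpace IsLocalRing
open Literature.AlgebraicGeometry.Resolution
open Summit.ResolutionOfSingularities.ResolutionOfSingularities.Theorems
open Summit.ResolutionOfSingularities.ResolutionOfSingularities.Theorems.WeakOrderReduction
open Summit.ResolutionOfSingularities.ResolutionOfSingularities.Theorems.DeltaFaceCutClasses
open Summit.ResolutionOfSingularities.ResolutionOfSingularities.Theorems.RelativeDeltaCut
open Summit.ResolutionOfSingularities.ResolutionOfSingularities.Theorems.CurveLeafExit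
open Summit.ResolutionOfSingularities.ResolutionOfSingularities.Theorems.PinchCut

namespace Summit.ResolutionOfSingularities.ResolutionOfSingularities.Theorems.JetCut

/-- **JET-TWO-CURVE point** (NEW class, leaf (J2) — the typed NEXT decided piece inside the jet-special residual): `y`
lies on (or is the generic point of) a Top-isolated, uniformly jet-two-shallow curve.  DEFINITION (NEW class).
(Sources: Hironaka1967; CossartJannsenSaito2020 Ch. 2.) -/
def IsJetTwoCurvePt {Y : Scheme.{0}} (I : Y.IdealSheafData) (n : ℕ) (y : Y) : Prop :=
  ∃ η : Y, η ⤳ y ∧ IsTopIsolatedClosure I n η ∧ IsUniformJetTwoCurve I n η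

/-- **JET-TWO-SPECIAL core point** (the residual of the residual, LOCATED): jet-special and NOT a jet-two-curve point —
on every Top-isolated regular clean curve through `y`, over some closed point a near point of order `n` survives the
blow-up of the curve AND (the near-point locus is not a regular curve in `Supp(I₁, n)` there, or) a near point survives
the blow-up of the near-point curve too: DEPTH ≥ 3 (`deeptail⁺:2`), non-curve near-point loci, deep / power pinches,
ISO-adjacent material.  DEFINITION (NEW class). [folklore] -/
def IsJetTwoSpecialPt {k : Type} [Field k] {Y : Scheme.{0}} (g : Y ⟶ Spec (.of k)) (hY : Scheme.IsRegular Y)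
    (I : Y.IdealSheafData) (n : ℕ) (y : Y) : Prop :=
  IsJetSpecialPt g hY I n y ∧ ¬ IsJetTwoCurvePt I n y

/-- (J) ⊆ (J2) at a closed point.  KERNEL (PROVED). [folklore] -/
theorem isJetTwoShallowAt_of_isJetShallowAt {Y : Scheme.{0}} {I : Y.IdealSheafData} {n : ℕ} {η y : Y} :
    IsJetShallowAt I n η y → IsJetTwoShallowAt I n η y := by
  rintro ⟨h, d, c, v, hc, hcv, hrank, hle, hJ⟩
  exact ⟨h, d, c, v, hc, hcv, hrank, hle, jetTwoShallow_of_jetShallow hJ⟩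

/-- (J) ⊆ (J2) along a curve.  KERNEL (PROVED). [folklore] -/
theorem isUniformJetTwoCurve_of_isUniformJetCurve {Y : Scheme.{0}} {I : Y.IdealSheafData} {n : ℕ} {η : Y} :
    IsUniformJetCurve I n η → IsUniformJetTwoCurve I n η := by
  rintro ⟨hη, hall⟩
  exact ⟨hη, fun y hy hcl => isJetTwoShallowAt_of_isJetShallowAt (hall y hy hcl)⟩

/-- (J) ⊆ (J2) as classes: every jet-curve point is a jet-two-curve point.  KERNEL (PROVED). [folklore] -/
theorem isJetTwoCurvePt_of_isJetCurvePt {Y : Scheme.{0}} {I : Y.IdealSheafData} {n : ℕ} {y : Y} :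
    IsJetCurvePt I n y → IsJetTwoCurvePt I n y := by
  rintro ⟨η, hη, htop, hJ⟩
  exact ⟨η, hη, htop, isUniformJetTwoCurve_of_isUniformJetCurve hJ⟩

/-- (C) ⊆ (J2): every cone-curve point (g14) is a jet-two-curve point, marking `n ≥ 1`.  KERNEL (PROVED). [folklore] -/
theorem isJetTwoCurvePt_of_isConeCurvePt {Y : Scheme.{0}} {I : Y.IdealSheafData} {n : ℕ} (hn : n ≠ 0) {y : Y} :
    IsConeCurvePt I n y → IsJetTwoCurvePt I n y :=
  fun h => isJetTwoCurvePt_of_isJetCurvePt (isJetCurvePt_of_isConeCurvePt hn h)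

/-- (CT) ⊆ (J2) [rev 1]: every cone-tail-curve point is a jet-two-curve point, marking `n ≥ 2`.  KERNEL (PROVED). [folklore] -/
theorem isJetTwoCurvePt_of_isConeTailCurvePt {Y : Scheme.{0}} {I : Y.IdealSheafData} {n : ℕ} (hn : 2 ≤ n) {y : Y} :
    IsConeTailCurvePt I n y → IsJetTwoCurvePt I n y :=
  fun h => isJetTwoCurvePt_of_isJetCurvePt (isJetCurvePt_of_isConeTailCurvePt hn h)

/-- ENGINE (J2) implies ENGINE (J) (and hence g14's ENGINE (C)).  KERNEL (PROVED). [folklore] -/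
theorem jetExit_of_jetTwoExit : JetTwoExit → JetExit := by
  intro h2 Y hY I n hn η hJ
  exact h2 Y hY I n hn η (isUniformJetTwoCurve_of_isUniformJetCurve hJ)

/-- ENGINE (J2) implies g14's ENGINE (C).  KERNEL (PROVED). [folklore] -/
theorem flatConeExit_of_jetTwoExit : JetTwoExit → FlatConeExit :=
  fun h => flatConeExit_of_jetExit (jetExit_of_jetTwoExit h)

/-- **The jet-special residual SPLITS BY LETTER into its typed next piece and the depth-≥-3 remainder**: a jet-special
core point is a jet-two-curve point or jet-two-special.  KERNEL (PROVED, `Classical.em`). [folklore] -/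
theorem isJetSpecialPt_split {k : Type} [Field k] {Y : Scheme.{0}} {g : Y ⟶ Spec (.of k)} {hY : Scheme.IsRegular Y}
    {I : Y.IdealSheafData} {n : ℕ} {y : Y} (h : IsJetSpecialPt g hY I n y) :
    IsJetTwoCurvePt I n y ∨ IsJetTwoSpecialPt g hY I n y := by
  by_cases h2 : IsJetTwoCurvePt I n y
  · exact Or.inl h2
  · exact Or.inr ⟨h, h2⟩

/-- A jet-two-special point is jet-special (the residual shrinks by letter).  KERNEL (PROVED). [folklore] -/
theorem isJetSpecialPt_of_isJetTwoSpecialPt {k : Type} [Field k] {Y : Scheme.{0}} {g : Y ⟶ Spec (.of k)}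
    {hY : Scheme.IsRegular Y} {I : Y.IdealSheafData} {n : ℕ} {y : Y} :
    IsJetTwoSpecialPt g hY I n y → IsJetSpecialPt g hY I n y :=
  fun h => h.1

/-! ## §J4  The graded statements (fresh-data frame = the binders of `WeakOrderReduction.SeqDimFour`) -/

/-- **`SeqJGen n`** — weak order reduction in dimension four at marking `n` for data ALL of whose top points are of
class ≥ 2, near-generic (g10), δ-generic (g11), curve-generic (g12), rel-curve-generic or flat-curve (g13), pinch-curve
or cone-curve (g14), or JET-CURVE points (g15).  [DECIDED-MOD-PORT relative to `SeqDimFour 2 n`: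
`jGenRungAt_of_engines`.]  STATEMENT SCHEMA. (Sources: BierstoneGrigorievMilmanWlodarczyk2011 §3.1; CossartPiltant2008
Prop. 4.2; Hironaka1967.) -/
def SeqJGen (n : ℕ) : Prop :=
  ∀ p : ℕ, p.Prime → ∀ (k : Type) [Field k] [CharP k p]
    (Y : Scheme.{0}) (g : Y ⟶ Spec (.of k)), IsSeparated g → LocallyOfFiniteType g → QuasiCompact g →
    ∀ hY : Scheme.IsRegular Y, topologicalKrullDim Y ≤ 4 →
    ∀ I : Y.IdealSheafData, (∀ y : Y, idealOrder I y ≤ ((n : ℕ) : ℕ∞)) →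
      (∀ y : Y, idealOrder I y = ((n : ℕ) : ℕ∞) →
        ClassGE g hY I n 2 y ∨ VeryNearCutClasses.IsNearGenericPt I n y ∨ IsDeltaGenericPt I n y ∨
          IsCurveGenericPt I n y ∨ IsRelCurveGenericPt I n y ∨ IsFlatCurvePt I n y ∨
          IsPinchCurvePt I n y ∨ IsConeCurvePt I n y ∨ IsJetCurvePt I n y) →
      ∃ t : CentreSeq Y, WeakResolution t (⟨I, [], n⟩ : MarkedIdeal Y)

end Summit.ResolutionOfSingularities.ResolutionOfSingularities.Theorems.JetCut
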